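import Summits.RiemannHypothesis.RiemannHypothesis.Theorems.JensenLogBandCanaryDefs
import Summits.RiemannHypothesis.RiemannHypothesis.Theorems.JensenLogBandCanaryArith

/-!
# E-CANARY-128 — D3 file 5/8: enclosures of the finite sums of the contract (`r_n`, `z^k/k!`, `canaryS j N z_c`)

RH-FREE. From the data box (`RatioEncloses (mkBox 240 cs) γ`, `γ = xiTaylorCoeffFrom128`) the checker builds
* `rhoFI I ∋ ρ` for a box entry `I` (`FI.ofIv`: outward rounding of a rational interval to a dyadic one),
* `rbArr box nmax`: dyadic intervals `∋ r_n = γ(n)/γ(0)` (`= canaryR n`), `n ≤ nmax` (products `FI.mulPos`),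
* `pzArr a b N`: complex boxes `∋ z_c^k/k!`, `z_c = (a + b·I)/2`, `k ≤ N` (EXACT Gaussian-integer powers, one rounding),
* `sumS rb pz j N U`: integer bounds at unit `2^U` for the real and imaginary parts of `Σ_{k ≤ N−j} r_{k+j} z_c^k/k!`
  (`= canaryS j N z_c` for `γ = xiTaylorCoeffFrom128`),
each with its inclusion theorem. Pattern: `…CoeffSmallTableSound`. Nothing here bears on the truth of RH.
-/

-- D-0017: the doubled namespace is by design.
set_option linter.dupNamespace false
set_option autoImplicit false

namespace Summit.RiemannHypothesis.RiemannHypothesis.Theorems.JensenPolynomials.LogBand.Canary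

open Summit.RiemannHypothesis.RiemannHypothesis.Theorems.JensenPolynomials.CoeffTable (Iv Mem lk mkBox RatioEncloses)
open scoped Nat

/-- Working precision: mantissas are normalised to `PB + 1 = 961` bits. -/
def PB : ℕ := 960

/-! ## A rational interval as a dyadic interval -/

/-- Outward rounding of a rational interval `I = (lo, hi)` to a dyadic interval with `T` fractional bits. -/
def FI.ofIv (P T : ℕ) (I : Iv) : FI :=
  FI.norm P ⟨⌊I.1 * (2 : ℚ) ^ T⌋, ⌈I.2 * (2 : ℚ) ^ T⌉, -(T : ℤ)⟩

/-- `FI.ofIv` encloses every real of the rational interval. -/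
theorem FI.ofIv_mem {r : ℝ} (P T : ℕ) {I : Iv} (h : CoeffTable.Mem r I) : FI.Mem r (FI.ofIv P T I) := by
  apply FI.norm_mem
  have h2T : (0 : ℝ) < (2 : ℝ) ^ (T : ℤ) := zpow_pos (by norm_num) _
  have hval : ∀ (m : ℤ), dy m (-(T : ℤ)) * (2 : ℝ) ^ (T : ℤ) = (m : ℝ) := by
    intro m; unfold dy
    rw [mul_assoc, ← zpow_add₀ (by norm_num : (2 : ℝ) ≠ 0)]; simp
  have hpow : (((2 : ℚ) ^ T : ℚ) : ℝ) = (2 : ℝ) ^ (T : ℤ) := by push_cast; rw [zpow_natCast]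
  constructor
  · show dy ⌊I.1 * (2 : ℚ) ^ T⌋ (-(T : ℤ)) ≤ r
    have hfl : ((⌊I.1 * (2 : ℚ) ^ T⌋ : ℤ) : ℝ) ≤ ((I.1 * (2 : ℚ) ^ T : ℚ) : ℝ) := by
      exact_mod_cast Int.floor_le (I.1 * (2 : ℚ) ^ T)
    have : dy ⌊I.1 * (2 : ℚ) ^ T⌋ (-(T : ℤ)) * (2 : ℝ) ^ (T : ℤ) ≤ r * (2 : ℝ) ^ (T : ℤ) := by
      rw [hval]
      calc ((⌊I.1 * (2 : ℚ) ^ T⌋ : ℤ) : ℝ) ≤ ((I.1 * (2 : ℚ) ^ T : ℚ) : ℝ) := hfl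
        _ = ((I.1 : ℚ) : ℝ) * (2 : ℝ) ^ (T : ℤ) := by push_cast; rw [zpow_natCast]
        _ ≤ r * (2 : ℝ) ^ (T : ℤ) := mul_le_mul_of_nonneg_right h.1 h2T.le
    exact le_of_mul_le_mul_right this h2T
  · show r ≤ dy ⌈I.2 * (2 : ℚ) ^ T⌉ (-(T : ℤ))
    have hce : ((I.2 * (2 : ℚ) ^ T : ℚ) : ℝ) ≤ ((⌈I.2 * (2 : ℚ) ^ T⌉ : ℤ) : ℝ) := by
      exact_mod_cast Int.le_ceil (I.2 * (2 : ℚ) ^ T)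
    have : r * (2 : ℝ) ^ (T : ℤ) ≤ dy ⌈I.2 * (2 : ℚ) ^ T⌉ (-(T : ℤ)) * (2 : ℝ) ^ (T : ℤ) := by
      rw [hval]
      calc r * (2 : ℝ) ^ (T : ℤ) ≤ ((I.2 : ℚ) : ℝ) * (2 : ℝ) ^ (T : ℤ) := mul_le_mul_of_nonneg_right h.2 h2T.le
        _ = ((I.2 * (2 : ℚ) ^ T : ℚ) : ℝ) := by push_cast; rw [zpow_natCast]
        _ ≤ ((⌈I.2 * (2 : ℚ) ^ T⌉ : ℤ) : ℝ) := hce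
    exact le_of_mul_le_mul_right this h2T

/-- Clamp the lower mantissa at `0` (sound for nonnegative reals). -/
def FI.clamp0 (x : FI) : FI := ⟨max 0 x.lo, x.hi, x.e⟩

/-- Clamping keeps nonnegative members. -/
theorem FI.clamp0_mem {r : ℝ} {x : FI} (hr : 0 ≤ r) (h : FI.Mem r x) : FI.Mem r x.clamp0 := by
  refine ⟨?_, h.2⟩
  show dy (max 0 x.lo) x.e ≤ r
  rcases le_total 0 x.lo with h0 | h0
  · rw [max_eq_right h0]; exact h.1
  · rw [max_eq_left h0]; simpa using hr

/-- The clamped lower mantissa is nonnegative. -/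
theorem FI.clamp0_lo_nonneg (x : FI) : 0 ≤ x.clamp0.lo := le_max_left _ _

/-- The `ρ`-box of a box entry (`1800` fractional bits, `961`-bit mantissas, lower end clamped at `0`). -/
def rhoFI (I : Iv) : FI := (FI.ofIv PB 1800 I).clamp0

/-- The `ρ`-box has a nonnegative lower mantissa. -/
theorem rhoFI_lo_nonneg (I : Iv) : 0 ≤ (rhoFI I).lo := FI.clamp0_lo_nonneg _

/-- Under the enclosure hypothesis (and positivity of `γ`), `rhoFI (lk box i) ∋ γ(i+1)/γ(i)`. -/
theorem rhoFI_mem {γ : ℕ → ℝ} {box : List Iv} (h : RatioEncloses box γ) (hγ : ∀ n, 0 < γ n)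
    {i : ℕ} (hi : i < box.length) : FI.Mem (γ (i + 1) / γ i) (rhoFI (lk box i)) :=
  FI.clamp0_mem (div_pos (hγ _) (hγ _)).le (FI.ofIv_mem PB 1800 (h i hi))

/-! ## Array access -/

/-- Total accessor for `FI` arrays. -/
def getFI (a : Array FI) (i : ℕ) : FI := if h : i < a.size then a[i] else default

/-- Total accessor for `CI` arrays. -/
def getCI (a : Array CI) (i : ℕ) : CI := if h : i < a.size then a[i] else default

/-- Access below the old size is unchanged by `push`. -/
theorem getFI_push_lt (a : Array FI) (x : FI) {i : ℕ} (hi : i < a.size) : getFI (a.push x) i = getFI a i := by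
  unfold getFI
  rw [dif_pos (by rw [Array.size_push]; omega), dif_pos hi, Array.getElem_push_lt]

/-- Access at the old size returns the pushed element. -/
theorem getFI_push_eq (a : Array FI) (x : FI) : getFI (a.push x) a.size = x := by
  unfold getFI
  rw [dif_pos (by rw [Array.size_push]; omega), Array.getElem_push_eq]

/-- Access below the old size is unchanged by `push`. -/
theorem getCI_push_lt (a : Array CI) (x : CI) {i : ℕ} (hi : i < a.size) : getCI (a.push x) i = getCI a i := by
  unfold getCI
  rw [dif_pos (by rw [Array.size_push]; omega), dif_pos hi, Array.getElem_push_lt]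

/-- Access at the old size returns the pushed element. -/
theorem getCI_push_eq (a : Array CI) (x : CI) : getCI (a.push x) a.size = x := by
  unfold getCI
  rw [dif_pos (by rw [Array.size_push]; omega), Array.getElem_push_eq]

/-! ## `r_n` enclosures -/

/-- `rbAux cs n cur k acc`: push `cur ∋ r_k`, then `cur·ρ_k ∋ r_{k+1}`, … (`n + 1` entries) onto `acc`. -/
def rbAux (box : List Iv) : ℕ → FI → ℕ → Array FI → Array FI
  | 0, cur, _, acc => acc.push cur
  | n + 1, cur, k, acc => rbAux box n (FI.mulPos PB cur (rhoFI (lk box k))) (k + 1) (acc.push cur)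

/-- `rbArr box nmax`: entries `0 … nmax`, entry `n ∋ r_n = γ(n)/γ(0)`. -/
def rbArr (box : List Iv) (nmax : ℕ) : Array FI := rbAux box nmax ⟨1, 1, 0⟩ 0 #[]

/-- Size of `rbAux`. -/
theorem rbAux_size (box : List Iv) : ∀ (n : ℕ) (cur : FI) (k : ℕ) (acc : Array FI),
    (rbAux box n cur k acc).size = acc.size + n + 1
  | 0, cur, k, acc => by simp [rbAux]
  | n + 1, cur, k, acc => by rw [rbAux, rbAux_size]; simp; omega

/-- `rbAux` does not touch the accumulator prefix. -/
theorem rbAux_prefix (box : List Iv) : ∀ (n : ℕ) (cur : FI) (k : ℕ) (acc : Array FI) {i : ℕ}, i < acc.size →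
    getFI (rbAux box n cur k acc) i = getFI acc i
  | 0, cur, k, acc, i, hi => by rw [rbAux, getFI_push_lt _ _ hi]
  | n + 1, cur, k, acc, i, hi => by
    rw [rbAux, rbAux_prefix box n _ _ _ (by rw [Array.size_push]; omega), getFI_push_lt _ _ hi]

/-- The invariant of `rbAux`: if `cur ∋ γ(k)/γ(0)` with nonnegative lower mantissa and the box encloses the ratios,
entry `acc.size + i` of the result encloses `γ(k+i)/γ(0)` (`i ≤ n`, `k + n ≤ cs.size`). -/
theorem rbAux_mem {γ : ℕ → ℝ} {box : List Iv} (h : RatioEncloses box γ) (hγ : ∀ n, 0 < γ n) :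
    ∀ (n : ℕ) (cur : FI) (k : ℕ) (acc : Array FI), k + n ≤ box.length → FI.Mem (γ k / γ 0) cur → 0 ≤ cur.lo →
      ∀ i, i ≤ n → FI.Mem (γ (k + i) / γ 0) (getFI (rbAux box n cur k acc) (acc.size + i)) ∧
        0 ≤ (getFI (rbAux box n cur k acc) (acc.size + i)).lo
  | 0, cur, k, acc, hk, hcur, hlo, i, hi => by
    have hi0 : i = 0 := by omega
    subst hi0
    rw [rbAux, Nat.add_zero, Nat.add_zero, getFI_push_eq]
    exact ⟨hcur, hlo⟩
  | n + 1, cur, k, acc, hk, hcur, hlo, i, hi => by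
    rw [rbAux]
    rcases Nat.eq_zero_or_pos i with rfl | hipos
    · have e0 : acc.size + 0 = acc.size := rfl
      rw [e0, rbAux_prefix box n _ _ _ (by rw [Array.size_push]; omega), getFI_push_eq]
      simpa using And.intro hcur hlo
    · -- entry acc.size + i = (acc.push cur).size + (i - 1)
      have hkc : k < box.length := by omega
      have hρ : FI.Mem (γ (k + 1) / γ k) (rhoFI (lk box k)) := rhoFI_mem h hγ hkc
      have hnext : FI.Mem (γ (k + 1) / γ 0) (FI.mulPos PB cur (rhoFI (lk box k))) := by
        have hprod : γ (k + 1) / γ 0 = γ k / γ 0 * (γ (k + 1) / γ k) := by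
          field_simp [(hγ k).ne', (hγ 0).ne']
        rw [hprod]
        exact FI.mulPos_mem PB hlo (rhoFI_lo_nonneg _) hcur hρ
      have hlo' : 0 ≤ (FI.mulPos PB cur (rhoFI (lk box k))).lo := FI.mulPos_lo_nonneg PB hlo (rhoFI_lo_nonneg _)
      have ih := rbAux_mem h hγ n _ (k + 1) (acc.push cur) (by omega) hnext hlo' (i - 1) (by omega)
      rw [Array.size_push] at ih
      have e1 : acc.size + 1 + (i - 1) = acc.size + i := by omega
      have e2 : k + 1 + (i - 1) = k + i := by omega
      rw [e1, e2] at ih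
      exact ih

/-- **`rbArr` encloses `r_n = γ(n)/γ(0)`** for `n ≤ nmax ≤ box.length`, with nonnegative lower mantissas. -/
theorem rbArr_mem {γ : ℕ → ℝ} {box : List Iv} (h : RatioEncloses box γ) (hγ : ∀ n, 0 < γ n) {nmax : ℕ}
    (hlen : nmax ≤ box.length) {n : ℕ} (hn : n ≤ nmax) :
    FI.Mem (γ n / γ 0) (getFI (rbArr box nmax) n) ∧ 0 ≤ (getFI (rbArr box nmax) n).lo := by
  have h1 : FI.Mem (γ 0 / γ 0) (⟨1, 1, 0⟩ : FI) := by
    rw [div_self (hγ 0).ne']; exact ⟨by simp [dy], by simp [dy]⟩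
  have := rbAux_mem h hγ nmax ⟨1, 1, 0⟩ 0 #[] (by omega) h1 (by norm_num) n hn
  simpa [rbArr] using this

/-! ## `z^k/k!` boxes from exact Gaussian-integer powers -/

/-- Fractional bits keeping `≈ PB` significant bits when rounding `(A + B·i)/Q`. -/
def exactBits (A B : ℤ) (Q : ℕ) : ℕ := PB + 2 + bitlen (Q : ℤ) - max (bitlen A) (bitlen B)

/-- The box of `(A + B·i)/Q`. -/
def pzBox (A B : ℤ) (Q : ℕ) : CI := CI.ofExact PB (exactBits A B Q) A B Q

/-- `pzAux a b n A B Q k acc`: with `A + B·i = (a + b·i)^k`, `Q = 2^k·k!`, push the boxes of `z^{k}/k!, …, z^{k+n}/(k+n)!`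
(`z = (a + b·i)/2`) onto `acc`. -/
def pzAux (a b : ℤ) : ℕ → ℤ → ℤ → ℕ → ℕ → Array CI → Array CI
  | 0, A, B, Q, _, acc => acc.push (pzBox A B Q)
  | n + 1, A, B, Q, k, acc =>
      pzAux a b n (A * a - B * b) (A * b + B * a) (Q * (2 * (k + 1))) (k + 1) (acc.push (pzBox A B Q))

/-- `pzArr a b N`: entries `0 … N`, entry `k ∋ z^k/k!`, `z = (a + b·i)/2`. -/
def pzArr (a b : ℤ) (N : ℕ) : Array CI := pzAux a b N 1 0 1 0 #[]

/-- `pzAux` does not touch the accumulator prefix. -/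
theorem pzAux_prefix (a b : ℤ) : ∀ (n : ℕ) (A B : ℤ) (Q k : ℕ) (acc : Array CI) {i : ℕ}, i < acc.size →
    getCI (pzAux a b n A B Q k acc) i = getCI acc i
  | 0, A, B, Q, k, acc, i, hi => by rw [pzAux, getCI_push_lt _ _ hi]
  | n + 1, A, B, Q, k, acc, i, hi => by
    rw [pzAux, pzAux_prefix a b n _ _ _ _ _ (by rw [Array.size_push]; omega), getCI_push_lt _ _ hi]

/-- The exact identity behind `pzBox`: `z^k/k! = (A + B·i)/Q` when `A + B·i = (a+b·i)^k`, `Q = 2^k·k!`. -/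
theorem pieceCentre_pow_div (a b : ℤ) {k : ℕ} {A B : ℤ} {Q : ℕ}
    (hAB : ((A : ℂ) + (B : ℂ) * Complex.I) = (((a : ℂ) + (b : ℂ) * Complex.I)) ^ k) (hQ : Q = 2 ^ k * k !) :
    pieceCentre a b ^ k / (k ! : ℂ) = ((A : ℂ) + (B : ℂ) * Complex.I) / (Q : ℂ) := by
  rw [hAB, hQ, pieceCentre, div_pow]
  push_cast
  rw [div_div]

/-- The invariant of `pzAux`: entry `acc.size + i` encloses `z^{k+i}/(k+i)!` (`i ≤ n`). -/
theorem pzAux_mem (a b : ℤ) : ∀ (n : ℕ) (A B : ℤ) (Q k : ℕ) (acc : Array CI),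
    ((A : ℂ) + (B : ℂ) * Complex.I) = (((a : ℂ) + (b : ℂ) * Complex.I)) ^ k → Q = 2 ^ k * k ! →
      ∀ i, i ≤ n → CI.Mem (pieceCentre a b ^ (k + i) / ((k + i) ! : ℂ)) (getCI (pzAux a b n A B Q k acc) (acc.size + i))
  | 0, A, B, Q, k, acc, hAB, hQ, i, hi => by
    have hi0 : i = 0 := by omega
    subst hi0
    have e0 : acc.size + 0 = acc.size := rfl
    rw [pzAux, e0, getCI_push_eq, Nat.add_zero, pieceCentre_pow_div a b hAB hQ]
    exact CI.ofExact_mem PB _ A B (by rw [hQ]; positivity)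
  | n + 1, A, B, Q, k, acc, hAB, hQ, i, hi => by
    rw [pzAux]
    rcases Nat.eq_zero_or_pos i with rfl | hipos
    · have e0 : acc.size + 0 = acc.size := rfl
      rw [e0, pzAux_prefix a b n _ _ _ _ _ (by rw [Array.size_push]; omega), getCI_push_eq, Nat.add_zero,
        pieceCentre_pow_div a b hAB hQ]
      exact CI.ofExact_mem PB _ A B (by rw [hQ]; positivity)
    · have hAB' : (((A * a - B * b : ℤ) : ℂ) + ((A * b + B * a : ℤ) : ℂ) * Complex.I)
          = (((a : ℂ) + (b : ℂ) * Complex.I)) ^ (k + 1) := by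
        rw [pow_succ, ← hAB]; push_cast; ring_nf; rw [Complex.I_sq]; ring
      have hQ' : Q * (2 * (k + 1)) = 2 ^ (k + 1) * (k + 1)! := by
        rw [hQ, pow_succ, Nat.factorial_succ]; ring
      have ih := pzAux_mem a b n _ _ _ (k + 1) (acc.push (pzBox A B Q)) hAB' hQ' (i - 1) (by omega)
      rw [Array.size_push] at ih
      have e1 : acc.size + 1 + (i - 1) = acc.size + i := by omega
      have e2 : k + 1 + (i - 1) = k + i := by omega
      rw [e1, e2] at ih
      exact ih

/-- **`pzArr` encloses `z^k/k!`** (`z = pieceCentre a b`, `k ≤ N`). -/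
theorem pzArr_mem (a b : ℤ) {N k : ℕ} (hk : k ≤ N) :
    CI.Mem (pieceCentre a b ^ k / (k ! : ℂ)) (getCI (pzArr a b N) k) := by
  have := pzAux_mem a b N 1 0 1 0 #[] (by simp) (by simp) k hk
  simpa [pzArr] using this

/-! ## The accumulated sums `Σ_{k ≤ N−j} r_{k+j} z^k/k!` at unit `2^U` -/

/-- An integer box at unit `2^U` for a complex number. -/
def BoxAt (U : ℤ) (w : ℂ) (q : ℤ × ℤ × ℤ × ℤ) : Prop :=
  dy q.1 U ≤ w.re ∧ w.re ≤ dy q.2.1 U ∧ dy q.2.2.1 U ≤ w.im ∧ w.im ≤ dy q.2.2.2 U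

/-- `sumSAux rb pz j U n k rlo rhi ilo ihi`: add the rounded boxes of `r_{k+j}·(z^k/k!)`, …, `n` terms, to the
accumulator `(rlo, rhi, ilo, ihi)` (unit `2^U`). -/
def sumSAux (rb : Array FI) (pz : Array CI) (j : ℕ) (U : ℤ) : ℕ → ℕ → ℤ → ℤ → ℤ → ℤ → ℤ × ℤ × ℤ × ℤ
  | 0, _, rlo, rhi, ilo, ihi => (rlo, rhi, ilo, ihi)
  | n + 1, k, rlo, rhi, ilo, ihi =>
      let t := CI.mulFIpos (getFI rb (k + j)) (getCI pz k)
      sumSAux rb pz j U n (k + 1) (rlo + toUnitFloor t.rlo t.e U) (rhi + toUnitCeil t.rhi t.e U)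
        (ilo + toUnitFloor t.ilo t.e U) (ihi + toUnitCeil t.ihi t.e U)

/-- `sumS rb pz j N U`: integer box at unit `2^U` of `Σ_{k=0}^{N−j} r_{k+j}·z^k/k!`. -/
def sumS (rb : Array FI) (pz : Array CI) (j N : ℕ) (U : ℤ) : ℤ × ℤ × ℤ × ℤ :=
  sumSAux rb pz j U (N - j + 1) 0 0 0 0 0

/-- The invariant of `sumSAux`. -/
theorem sumSAux_mem {rb : Array FI} {pz : Array CI} {j : ℕ} {U : ℤ} {r : ℕ → ℝ} {p : ℕ → ℂ} {K₀ : ℕ}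
    (hr : ∀ m, m ≤ K₀ → FI.Mem (r m) (getFI rb m) ∧ 0 ≤ (getFI rb m).lo)
    (hp : ∀ m, m + j ≤ K₀ → CI.Mem (p m) (getCI pz m)) :
    ∀ (n k : ℕ) (rlo rhi ilo ihi : ℤ) (c : ℂ), k + n + j ≤ K₀ + 1 → BoxAt U c (rlo, rhi, ilo, ihi) →
      BoxAt U (c + ∑ i ∈ Finset.range n, (r (k + i + j) : ℂ) * p (k + i))
        (sumSAux rb pz j U n k rlo rhi ilo ihi)
  | 0, k, rlo, rhi, ilo, ihi, c, hk, hc => by simpa [sumSAux] using hc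
  | n + 1, k, rlo, rhi, ilo, ihi, c, hk, hc => by
    rw [sumSAux]
    have hkj : k + j ≤ K₀ := by omega
    have ht : CI.Mem ((r (k + j) : ℂ) * p k) (CI.mulFIpos (getFI rb (k + j)) (getCI pz k)) :=
      CI.mulFIpos_mem (hr _ hkj).2 (hr _ hkj).1 (hp _ hkj)
    set t := CI.mulFIpos (getFI rb (k + j)) (getCI pz k) with ht_def
    have hc' : BoxAt U (c + (r (k + j) : ℂ) * p k)
        (rlo + toUnitFloor t.rlo t.e U, rhi + toUnitCeil t.rhi t.e U,
          ilo + toUnitFloor t.ilo t.e U, ihi + toUnitCeil t.ihi t.e U) := by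
      obtain ⟨h1, h2, h3, h4⟩ := hc
      obtain ⟨t1, t2, t3, t4⟩ := ht
      refine ⟨?_, ?_, ?_, ?_⟩
      · simp only [dy_add, Complex.add_re]
        exact add_le_add h1 ((dy_toUnitFloor_le _ _ _).trans t1)
      · simp only [dy_add, Complex.add_re]
        exact add_le_add h2 (t2.trans (dy_le_toUnitCeil _ _ _))
      · simp only [dy_add, Complex.add_im]
        exact add_le_add h3 ((dy_toUnitFloor_le _ _ _).trans t3)
      · simp only [dy_add, Complex.add_im]
        exact add_le_add h4 (t4.trans (dy_le_toUnitCeil _ _ _))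
    have ih := sumSAux_mem hr hp n (k + 1) _ _ _ _ _ (by omega) hc'
    have hsum : c + ∑ i ∈ Finset.range (n + 1), (r (k + i + j) : ℂ) * p (k + i)
        = c + (r (k + j) : ℂ) * p k + ∑ i ∈ Finset.range n, (r (k + 1 + i + j) : ℂ) * p (k + 1 + i) := by
      rw [Finset.sum_range_succ']
      have hre : ∀ i : ℕ, (r (k + (i + 1) + j) : ℂ) * p (k + (i + 1)) = (r (k + 1 + i + j) : ℂ) * p (k + 1 + i) := by
        intro i
        rw [show k + (i + 1) + j = k + 1 + i + j by omega, show k + (i + 1) = k + 1 + i by omega]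
      simp only [hre, Nat.add_zero]
      ring
    rw [hsum]
    exact ih

/-- **`sumS` encloses `Σ_{k=0}^{N−j} r_{k+j}·z^k/k!`.** -/
theorem sumS_mem {rb : Array FI} {pz : Array CI} {j N : ℕ} {U : ℤ} {r : ℕ → ℝ} {p : ℕ → ℂ}
    (hr : ∀ m, m ≤ N → FI.Mem (r m) (getFI rb m) ∧ 0 ≤ (getFI rb m).lo)
    (hp : ∀ m, m + j ≤ N → CI.Mem (p m) (getCI pz m)) (hjN : j ≤ N) :
    BoxAt U (∑ k ∈ Finset.range (N - j + 1), (r (k + j) : ℂ) * p k) (sumS rb pz j N U) := by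
  have h0 : BoxAt U (0 : ℂ) (0, 0, 0, 0) := by simp [BoxAt]
  have := sumSAux_mem (K₀ := N) hr hp (N - j + 1) 0 0 0 0 0 0 (by omega) h0
  simpa [sumS] using this

end Summit.RiemannHypothesis.RiemannHypothesis.Theorems.JensenPolynomials.LogBand.Canary
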